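import Mathlib
import HarnessLib
import Summits.HubbardSuperconductivity.HubbardSuperconductivity.Theorems.KLProgrammeKLRegimeCountertermGridIdentity

/-!
# Route `KLProgramme` — child `KLRegimeCounterterm` (gen 3, `CountertermP2 klPredsV11 klWindowC`): the NODE IDENTITY (input (I1) of
# k3c3-p2's wholesale continuation, cell STATUS 2026-08-26T19:23:20Z) — at a flat-tube lattice momentum `p_k`, angle `θ_k = momentumAngle L k`,
# `ν_n(K)(θ_k) = K(k_F^K(θ_k)) + Σ_{i ≤ n} ℓ_i^G(K)(p_k)` for EVERY frame `K : TrigPolyC4v` (seat hubbard-kl-k3c3-p3)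

The telescoping of the G-pieces (`sum_eval_klTwoLegPieceG`: `Σ_{i ≤ n} ℓ_i^G(K)(p) = D_n^G(K)(p) − P^G(K)(p)` at every `p`) and the two grid
identities of `…CountertermGridIdentity` (`D_n^G(K)(p_k) = ν_n(K)(θ_k)`, `P^G(K)(p_k) = K(k_F(θ_k))` on the flat tube) give the node
identity in the exact form the continuation consumes, plus its general-site form (with the flat cutoff and the angular means) and the
two-scale form `ν_n(K)(θ_k) − ν_m(K)(θ_k) = Σ_{m < i ≤ n} ℓ_i^G(K)(p_k)`.  Proofs only; nothing is asserted about the Hubbard model.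
-/

noncomputable section

namespace Summit.HubbardSuperconductivity.HubbardSuperconductivity.Theorems.KLRegimeSplit

set_option linter.dupNamespace false -- summit = problem name (single-conjunct summit), D-0017

open Real Finset
open Literature.MathematicalPhysics.QuantumLattice Literature.Probability.LatticeModels
open Summit.HubbardSuperconductivity.HubbardSuperconductivity.Theorems.KLProgrammeLegKernels

section Model

variable (L M : ℕ) [NeZero L] [NeZero M]

/-- **NODE IDENTITY (flat tube).**  At a lattice momentum `p_k` of the flat tube (`|ε(p_k) − μ| ≤ klFlatR`), with `θ_k = momentumAngle L k`:
`ν_n(K)(θ_k) = K(k_F^K(θ_k)) + Σ_{i ≤ n} ℓ_i^G(K)(p_k)` — for EVERY frame `K : TrigPolyC4v` and every scale `n`. -/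
theorem klLocalPart_latticeAngle_eq_frameOnCurve_add_sum_pieces (β U μ : ℝ) (K : TrigPolyC4v) (n : ℕ) {k : TorusSite 2 L}
    (hk : |nambuXi L μ k| ≤ klFlatR) :
    klLocalPart L M β U μ K n (momentumAngle L k) =
      K.eval (klFermiPoint μ K (momentumAngle L k)) +
        ∑ i ∈ range (n + 1), (klTwoLegPieceG L M β U μ K i).eval (latticeMomentum L k) := by
  rw [sum_eval_klTwoLegPieceG, eval_klTwoLegPolyG_latticeMomentum_of_flat L M β U μ K n hk,
    eval_klFrameProjG_latticeMomentum_of_flat L μ K hk]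
  ring

/-- The node identity solved for the piece sum: `Σ_{i ≤ n} ℓ_i^G(K)(p_k) = ν_n(K)(θ_k) − K(k_F^K(θ_k))` on the flat tube. -/
theorem sum_eval_klTwoLegPieceG_latticeMomentum_of_flat (β U μ : ℝ) (K : TrigPolyC4v) (n : ℕ) {k : TorusSite 2 L}
    (hk : |nambuXi L μ k| ≤ klFlatR) :
    ∑ i ∈ range (n + 1), (klTwoLegPieceG L M β U μ K i).eval (latticeMomentum L k) =
      klLocalPart L M β U μ K n (momentumAngle L k) - K.eval (klFermiPoint μ K (momentumAngle L k)) := by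
  rw [klLocalPart_latticeAngle_eq_frameOnCurve_add_sum_pieces L M β U μ K n hk]
  ring

/-- **NODE IDENTITY, general site.**  At ANY lattice momentum: `Σ_{i ≤ n} ℓ_i^G(K)(p_k) = (m_n − m_K) + χ_flat(k)·((ν_n(K)(θ_k) − m_n) −
(K(k_F θ_k) − m_K))` with `m_n = mean ν_n(K)`, `m_K = mean (K∘k_F)` — the δμ-flow increment plus the cut-off mean-free increment. -/
theorem sum_eval_klTwoLegPieceG_latticeMomentum (β U μ : ℝ) (K : TrigPolyC4v) (n : ℕ) (k : TorusSite 2 L) :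
    ∑ i ∈ range (n + 1), (klTwoLegPieceG L M β U μ K i).eval (latticeMomentum L k) =
      (klAngularMean (klLocalPart L M β U μ K n) - klAngularMean (fun θ => K.eval (klFermiPoint μ K θ))) +
        klFlatCutoff L μ k *
          ((klLocalPart L M β U μ K n (momentumAngle L k) - klAngularMean (klLocalPart L M β U μ K n)) -
            (K.eval (klFermiPoint μ K (momentumAngle L k)) - klAngularMean (fun θ => K.eval (klFermiPoint μ K θ)))) := by
  rw [sum_eval_klTwoLegPieceG, eval_klTwoLegPolyG_latticeMomentum, eval_klFrameProjG_latticeMomentum]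
  ring

/-- **Two scales at one node**: `ν_n(K)(θ_k) − ν_m(K)(θ_k) = Σ_{m < i ≤ n} ℓ_i^G(K)(p_k)` on the flat tube (`m ≤ n`). -/
theorem klLocalPart_sub_klLocalPart_latticeAngle_eq_sum_pieces (β U μ : ℝ) (K : TrigPolyC4v) {m n : ℕ} (hmn : m ≤ n)
    {k : TorusSite 2 L} (hk : |nambuXi L μ k| ≤ klFlatR) :
    klLocalPart L M β U μ K n (momentumAngle L k) - klLocalPart L M β U μ K m (momentumAngle L k) =
      ∑ i ∈ Ioc m n, (klTwoLegPieceG L M β U μ K i).eval (latticeMomentum L k) := by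
  have hn := sum_eval_klTwoLegPieceG_latticeMomentum_of_flat L M β U μ K n hk
  have hm := sum_eval_klTwoLegPieceG_latticeMomentum_of_flat L M β U μ K m hk
  have hsplit : ∑ i ∈ range (n + 1), (klTwoLegPieceG L M β U μ K i).eval (latticeMomentum L k) =
      ∑ i ∈ range (m + 1), (klTwoLegPieceG L M β U μ K i).eval (latticeMomentum L k) +
        ∑ i ∈ Ioc m n, (klTwoLegPieceG L M β U μ K i).eval (latticeMomentum L k) := by
    rw [range_eq_Ico, range_eq_Ico]
    have h1 : Finset.Ico 0 (n + 1) = Finset.Ico 0 (m + 1) ∪ Finset.Ioc m n := by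
      ext i; simp only [Finset.mem_union, Finset.mem_Ico, Finset.mem_Ioc]; omega
    have h2 : Disjoint (Finset.Ico 0 (m + 1)) (Finset.Ioc m n) := by
      rw [Finset.disjoint_left]; intro i hi hi'; simp only [Finset.mem_Ico, Finset.mem_Ioc] at hi hi'; omega
    rw [h1, Finset.sum_union h2]
  linarith

/-- **The piece at a node**: `ℓ_{n+1}^G(K)(p_k) = ν_{n+1}(K)(θ_k) − ν_n(K)(θ_k)` on the flat tube. -/
theorem eval_klTwoLegPieceG_succ_latticeMomentum_of_flat (β U μ : ℝ) (K : TrigPolyC4v) (n : ℕ) {k : TorusSite 2 L}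
    (hk : |nambuXi L μ k| ≤ klFlatR) :
    (klTwoLegPieceG L M β U μ K (n + 1)).eval (latticeMomentum L k) =
      klLocalPart L M β U μ K (n + 1) (momentumAngle L k) - klLocalPart L M β U μ K n (momentumAngle L k) := by
  rw [klTwoLegPieceG_succ, eval_fsub, eval_klTwoLegPolyG_latticeMomentum_of_flat L M β U μ K (n + 1) hk,
    eval_klTwoLegPolyG_latticeMomentum_of_flat L M β U μ K n hk]

/-- **The scale-0 piece at a node**: `ℓ_0^G(K)(p_k) = ν_0(K)(θ_k) − K(k_F θ_k)` on the flat tube. -/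
theorem eval_klTwoLegPieceG_zero_latticeMomentum_of_flat (β U μ : ℝ) (K : TrigPolyC4v) {k : TorusSite 2 L}
    (hk : |nambuXi L μ k| ≤ klFlatR) :
    (klTwoLegPieceG L M β U μ K 0).eval (latticeMomentum L k) =
      klLocalPart L M β U μ K 0 (momentumAngle L k) - K.eval (klFermiPoint μ K (momentumAngle L k)) := by
  rw [klTwoLegPieceG_zero, eval_fsub, eval_klTwoLegPolyG_latticeMomentum_of_flat L M β U μ K 0 hk,
    eval_klFrameProjG_latticeMomentum_of_flat L μ K hk]

end Model

end Summit.HubbardSuperconductivity.HubbardSuperconductivity.Theorems.KLRegimeSplit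

end
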